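import Summits.QuantumFields.YangMills.Theorems.FluctuationComparisonRegPrIntLS2BetaResidualSubgroup
import Summits.QuantumFields.YangMills.Theorems.FluctuationComparisonRegPrIntLS2BetaResidualGaugeCentral
import Summits.QuantumFields.YangMills.Theorems.FluctuationComparisonRegPrIntLS2BetaSignedCombKill
import HarnessLib

/-!
# (RG-K) The stabiliser of the enlarged residual action: `hstab` ∕ `hfix` for LIMIT-INST

Sixth (definition-free) file of the RG-K letters for LINE g18-1 `Cruxes/FluctuationComparisonRegPrIntL/Lines/semiclassical_s2beta.lean`
(crux `stmt-QuantumFields-20520`, row LAPLACE ∕ LIMIT; w5-20520 g13's GAP 3 «`hstab hfix` with displayed `Sst`»).  The Laplace-orbit door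
(`…LaplaceLimit.laplaceLimit_corner(_on')`, lit `tendsto_laplaceMethod_orbit_indicator_of_continuous`) asks for a set `Sst` of group
elements with `hstab : act k (σ 0) = σ 0 → k ∈ Sst` and `hfix : s ∈ Sst → act s (σ y) = σ y`.  For the (β″) action `pivotAct ι` of
`↥(residualSubgroup F hJK) × (C → SU(2))` the honest `Sst` is «CENTRAL SHEETS × {1}», and this file proves both rows by composing three
landed letters: the group split ✓`pivotAct_eq_self_iff` (FILE 3), the rooted decomposition ✓`exists_central_isResidual_of_residual` (FILE 5:
residual = central constant × print's rooted `IsResidual`), and the chart side's ROOTED OFF-PIVOT FREENESS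
✓`…S2BetaSignedCombKill.eq_one_of_isResidual_of_gaugeAct_eq_on_combSet` (px21 g9: a rooted transformation fixing a field on the comb bonds
is trivial).  The one geometric input is that the pivots avoid the comb (`hcomb`; for `ι := iterCentralBond (K−J)` it is px21's
✓`…S2BetaSignedCombCount.iterCentralBond_not_mem_combSet`).

* ★★ `pivotAct_eq_self_imp_central` — `pivotAct ι k z = z ⟹ k.2 = 1 ∧ ↑k.1 ≡ c` for a central `c` (`hstab`);
* ★ `pivotAct_eq_self_iff_central` — the stabiliser of ANY fine field is exactly the central sheets × `{1}`;
* `pivotAct_central_sheet_eq` — central sheets × `{1}` fix every field (`hfix`, = ✓`pivotAct_const_sheet_eq_self`).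

HONEST: group bookkeeping over landed letters; this file proves NO stub of the line — EXW, GAP♯, LAPLACE (CHART∞ ∕ LIMIT ∕ KNIT ∕ DECAY),
H4ᶜ, LFR♯ᶜ, S2β and crux 20520 stay OPEN; rung R3 (YM₃ on T³) is NOT d = 4, NOT infinite volume, NOT a mass gap, NOT Clay; the Yang–Mills
mass gap is NOT proved.
-/

noncomputable section

open MeasureTheory Filter Topology Set
open Literature.MathematicalPhysics.QuantumFieldTheory.Balaban1983to89
open Literature.MathematicalPhysics.QuantumFieldTheory.Balaban1983to89.T3ContinuumYM3Torus
open Literature.MathematicalPhysics.QuantumFieldTheory.Balaban1983to89.T3UnitLawDensityEML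
open Literature.MathematicalPhysics.QuantumFieldTheory.Balaban1983to89.T3TiltDescent
open Literature.MathematicalPhysics.QuantumFieldTheory.Balaban1983to89.B15DeterminingSets (embIter)
open Literature.MathematicalPhysics.QuantumFieldTheory.Balaban1983to89.B12GaugeOrbits021 (IsResidual)
open scoped Literature.MathematicalPhysics.QuantumFieldTheory.Balaban1983to89.T3OrbitAverage
open Summit.QuantumFields.YangMills.Theorems.FluctuationComparisonRegPrIntLS2BetaResidualGauge
open Summit.QuantumFields.YangMills.Theorems.FluctuationComparisonRegPrIntLS2BetaResidualSubgroup
open Summit.QuantumFields.YangMills.Theorems.FluctuationComparisonRegPrIntLS2BetaResidualGaugeCentral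
open Summit.QuantumFields.YangMills.Theorems.FluctuationComparisonRegPrIntLS2BetaSignedCombKill (combSet eq_one_of_isResidual_of_gaugeAct_eq_on_combSet)

namespace Summit.QuantumFields.YangMills.Theorems.FluctuationComparisonRegPrIntLS2BetaResidualGaugeStabiliser

variable (F : T3Family) {J K : ℕ} (hJK : J ≤ K) {C : Type*} (ι : C → PBond (F.P K) 0)

/-- A residual transformation FIXING A FINE FIELD ON THE COMB BONDS of level `K − J` is a CENTRAL CONSTANT (rooted decomposition ∘ the chart
side's rooted off-pivot freeness). [cite: Balaban1985Variational, (4) p.278 and (181) p.307; Balaban1987RG1, p.256 (three sentences after (0.21))] -/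
theorem exists_central_eq_const_of_residual_of_gaugeAct_eq_on_combSet {w : Site (F.P K) 0 → Matrix.specialUnitaryGroup (Fin 2) ℂ}
    (hw : ∀ U : GaugeField (F.P K) 0 (Matrix.specialUnitaryGroup (Fin 2) ℂ),
      descendTo F ℰp J K hJK (GaugeField.gaugeAct w U) = descendTo F ℰp J K hJK U)
    {z : GaugeField (F.P K) 0 (Matrix.specialUnitaryGroup (Fin 2) ℂ)}
    (hz : ∀ b ∈ (combSet (K - J) : Set (PBond (F.P K) 0)), GaugeField.gaugeAct w z b = z b) :
    ∃ c : Matrix.specialUnitaryGroup (Fin 2) ℂ, (∀ h : Matrix.specialUnitaryGroup (Fin 2) ℂ, c * h = h * c) ∧ w = fun _ => c := by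
  obtain ⟨c, hc, hroot, hact⟩ := exists_central_isResidual_of_residual F hJK hw
  refine ⟨c, hc, ?_⟩
  have hk : K - J ≤ (F.P K).m + (F.P K).K := by show K - J ≤ F.m + K; omega
  have hone : ((fun _ => c⁻¹) * w : Site (F.P K) 0 → Matrix.specialUnitaryGroup (Fin 2) ℂ) = fun _ => 1 :=
    eq_one_of_isResidual_of_gaugeAct_eq_on_combSet hk hroot (U := z) fun b hb => by rw [hact z]; exact hz b hb
  funext x
  have hx := congrFun hone x
  simp only [Pi.mul_apply] at hx
  rw [inv_mul_eq_one] at hx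
  exact hx.symm

/-- ★★ **`hstab` — THE STABILISER OF THE (β″) ACTION IS «CENTRAL SHEETS × {1}»**: if the pivots avoid the comb bonds (`hcomb`; for
`ι := iterCentralBond (K − J)` this is `…S2BetaSignedCombCount.iterCentralBond_not_mem_combSet`) and `pivotAct ι k z = z`, then the pivot
component of `k` is trivial and its residual component is a CENTRAL CONSTANT sheet (`≡ ±1` on `SU(2)`).
[cite: Balaban1985Variational, Thm 1 (10) p.279 and (181) p.307; Balaban1985Averaging, (8) p.18] -/
theorem pivotAct_eq_self_imp_central (hι : Function.Injective ι)
    (hcomb : ∀ b ∈ (combSet (K - J) : Set (PBond (F.P K) 0)), ¬ ∃ c, ι c = b)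
    (k : residualSubgroup F hJK × (C → Matrix.specialUnitaryGroup (Fin 2) ℂ))
    (z : GaugeField (F.P K) 0 (Matrix.specialUnitaryGroup (Fin 2) ℂ)) (h : pivotAct F hJK ι k z = z) :
    k.2 = 1 ∧ ∃ c : Matrix.specialUnitaryGroup (Fin 2) ℂ, (∀ g : Matrix.specialUnitaryGroup (Fin 2) ℂ, c * g = g * c) ∧
      (k.1 : Site (F.P K) 0 → Matrix.specialUnitaryGroup (Fin 2) ℂ) = fun _ => c := by
  obtain ⟨h2, hoff⟩ := (pivotAct_eq_self_iff F hJK ι hι k z).mp h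
  exact ⟨h2, exists_central_eq_const_of_residual_of_gaugeAct_eq_on_combSet F hJK k.1.2 fun b hb => hoff b (hcomb b hb)⟩

/-- `hfix` — a central sheet paired with the trivial pivot element fixes EVERY fine field (= ✓`pivotAct_const_sheet_eq_self`, restated next
to `hstab` for the consumer). [cite: Balaban1985Averaging, (8) p.18] -/
theorem pivotAct_central_sheet_eq {c : Matrix.specialUnitaryGroup (Fin 2) ℂ}
    (hc : ∀ g : Matrix.specialUnitaryGroup (Fin 2) ℂ, c * g = g * c) (z : GaugeField (F.P K) 0 (Matrix.specialUnitaryGroup (Fin 2) ℂ)) :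
    pivotAct F hJK ι (⟨fun _ => c, const_mem_residualSubgroup_of_comm F hJK hc⟩, 1) z = z :=
  pivotAct_const_sheet_eq_self F hJK ι hc z

/-- ★ **THE STABILISER OF ANY FINE FIELD IS EXACTLY «CENTRAL SHEETS × {1}»** (pivots off the comb, injective pivot map): the two rows
`hstab`∕`hfix` as one `iff`, independent of the field `z` — so the orbit dimension of the (β″) action is DATUM-INDEPENDENT, the Morse–Bott
input of the Laplace-orbit door. [cite: Balaban1985Variational, Thm 1 (10) p.279 and (181) p.307] -/
theorem pivotAct_eq_self_iff_central (hι : Function.Injective ι)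
    (hcomb : ∀ b ∈ (combSet (K - J) : Set (PBond (F.P K) 0)), ¬ ∃ c, ι c = b)
    (k : residualSubgroup F hJK × (C → Matrix.specialUnitaryGroup (Fin 2) ℂ))
    (z : GaugeField (F.P K) 0 (Matrix.specialUnitaryGroup (Fin 2) ℂ)) :
    pivotAct F hJK ι k z = z ↔
      k.2 = 1 ∧ ∃ c : Matrix.specialUnitaryGroup (Fin 2) ℂ, (∀ g : Matrix.specialUnitaryGroup (Fin 2) ℂ, c * g = g * c) ∧
        (k.1 : Site (F.P K) 0 → Matrix.specialUnitaryGroup (Fin 2) ℂ) = fun _ => c := by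
  refine ⟨pivotAct_eq_self_imp_central F hJK ι hι hcomb k z, ?_⟩
  rintro ⟨h2, c, hc, hk⟩
  have hk' : k = (⟨fun _ => c, const_mem_residualSubgroup_of_comm F hJK hc⟩, 1) := by
    refine Prod.ext (Subtype.ext hk) h2
  rw [hk']
  exact pivotAct_const_sheet_eq_self F hJK ι hc z

end Summit.QuantumFields.YangMills.Theorems.FluctuationComparisonRegPrIntLS2BetaResidualGaugeStabiliser

end
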